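import Summits.CriticalPhenomena.SAWScalingLimit.Theorems.SAWReversalUpgradeAttachReversalDefs

/-!
# Attachment reversal: invariance of the attachment data under monotone reparametrisation

Helper file for item `AttachReversal` of route `SAWReversalUpgrade` (stmt-CriticalPhenomena-18007).
The route's attachment `let`-block (file `SAWReversalUpgradeAttachReversalDefs`: `lastA`, `firstB`,
`midSet`, `pAcc`, `qEx`, `sAcc`, `rEx`, `uMid`, `vMid`, `attSet`) is computed from an extended
polyline `R : ℝ → ℂ`. If `R` is replaced by `R ∘ h` for a continuous monotone `h : ℝ → ℝ` with
`h 0 = 0`, `h 1 = 1` (a reparametrisation of `[0, 1]`, possibly with plateaus), then the TIMES of the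
block are carried by `h` (`h (lastA a (R ∘ h)) = lastA a R`, …, `h (vMid … (R ∘ h)) = vMid … R`) and
the SETS and POINTS of the block are unchanged (`midSet`, `pAcc`, `qEx`, `sAcc`, `rEx`, and `attSet`
as soon as `uMid ≤ vMid` on the reparametrised side). This is applied twice in the proof of
`AttachReversal`: the dyadic polyline of a walk is `affineInterp ∘ dyadicTime` (tree:
`polyline_cons_apply`), and so is the polyline of the reversed walk, with the SAME time change.

Elementary real analysis (`Monotone.map_csSup_of_continuousAt`, the intermediate value theorem).
-/

noncomputable section

open Set Function
open Literature.Probability.RandomPlanarGeometry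

namespace Summit.CriticalPhenomena.SAWScalingLimit.Theorems.AttachReversal

section Generic

variable {h : ℝ → ℝ}

/-- A continuous monotone `h` maps `[α, β]` onto `[h α, h β]`. -/
theorem image_Icc_of_monotone (hh : Continuous h) (hmono : Monotone h) {α β : ℝ} (hαβ : α ≤ β) :
    h '' Icc α β = Icc (h α) (h β) :=
  (hmono.image_Icc_subset).antisymm (intermediate_value_Icc hαβ hh.continuousOn)

/-- Transport of a constrained set through `h`: `h '' {u ∈ [α, β] | P (h u)} = {t ∈ [h α, h β] | P t}`. -/
theorem image_sep_Icc (hh : Continuous h) (hmono : Monotone h) {α β : ℝ} (hαβ : α ≤ β)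
    (P : ℝ → Prop) :
    h '' {u | u ∈ Icc α β ∧ P (h u)} = {t | t ∈ Icc (h α) (h β) ∧ P t} := by
  ext t
  constructor
  · rintro ⟨u, ⟨hu, hP⟩, rfl⟩
    exact ⟨⟨hmono hu.1, hmono hu.2⟩, hP⟩
  · rintro ⟨ht, hP⟩
    have : t ∈ h '' Icc α β := by rw [image_Icc_of_monotone hh hmono hαβ]; exact ht
    obtain ⟨u, hu, rfl⟩ := this
    exact ⟨u, ⟨hu, hP⟩, rfl⟩

/-- `h` carries the supremum of a nonempty set bounded above to the supremum of its image. -/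
theorem map_sSup (hh : Continuous h) (hmono : Monotone h) {S : Set ℝ} (hne : S.Nonempty)
    (hbdd : BddAbove S) : h (sSup S) = sSup (h '' S) :=
  hmono.map_csSup_of_continuousAt hh.continuousAt hne hbdd

/-- `h` carries the infimum of a nonempty set bounded below to the infimum of its image. -/
theorem map_sInf (hh : Continuous h) (hmono : Monotone h) {S : Set ℝ} (hne : S.Nonempty)
    (hbdd : BddBelow S) : h (sInf S) = sInf (h '' S) :=
  hmono.map_csInf_of_continuousAt hh.continuousAt hne hbdd

/-- Supremum version with the empty case: if `h 0 = 0` then `h (sSup S) = sSup (h '' S)` for every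
set bounded above (`sSup ∅ = 0`). -/
theorem map_sSup' (hh : Continuous h) (hmono : Monotone h) (h0 : h 0 = 0) {S : Set ℝ}
    (hbdd : BddAbove S) : h (sSup S) = sSup (h '' S) := by
  rcases S.eq_empty_or_nonempty with rfl | hne
  · simp [h0]
  · exact map_sSup hh hmono hne hbdd

/-- Infimum version with the empty case. -/
theorem map_sInf' (hh : Continuous h) (hmono : Monotone h) (h0 : h 0 = 0) {S : Set ℝ}
    (hbdd : BddBelow S) : h (sInf S) = sInf (h '' S) := by
  rcases S.eq_empty_or_nonempty with rfl | hne
  · simp [h0]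
  · exact map_sInf hh hmono hne hbdd

end Generic

section Data

variable {a b : ℂ} {Φ : ℂ → ℂ} {e : ℝ} {R : ℝ → ℂ} {h : ℝ → ℝ}

/-- The set `{0} ∪ {u ∈ [0,1] | R u = a}` behind `lastA` is nonempty, bounded, and compact for
continuous `R`. -/
theorem lastASet_bddAbove (a : ℂ) (R : ℝ → ℂ) :
    BddAbove ({(0:ℝ)} ∪ {u | u ∈ Icc (0:ℝ) 1 ∧ R u = a}) :=
  ⟨1, by rintro u (rfl | ⟨hu, -⟩) <;> [exact zero_le_one; exact hu.2]⟩

/-- The set behind `firstB` is bounded below. -/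
theorem firstBSet_bddBelow (b : ℂ) (R : ℝ → ℂ) :
    BddBelow ({(1:ℝ)} ∪ {u | u ∈ Icc (0:ℝ) 1 ∧ R u = b}) :=
  ⟨0, by rintro u (rfl | ⟨hu, -⟩) <;> [exact zero_le_one; exact hu.1]⟩

/-- `lastA a R ∈ [0, 1]`. -/
theorem lastA_mem_Icc (a : ℂ) (R : ℝ → ℂ) : lastA a R ∈ Icc (0:ℝ) 1 := by
  have hne : ({(0:ℝ)} ∪ {u | u ∈ Icc (0:ℝ) 1 ∧ R u = a}).Nonempty := ⟨0, Or.inl rfl⟩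
  refine ⟨le_csSup (lastASet_bddAbove a R) (Or.inl rfl), csSup_le hne ?_⟩
  rintro u (rfl | ⟨hu, -⟩)
  · exact zero_le_one
  · exact hu.2

/-- `firstB b R ∈ [0, 1]`. -/
theorem firstB_mem_Icc (b : ℂ) (R : ℝ → ℂ) : firstB b R ∈ Icc (0:ℝ) 1 := by
  have hne : ({(1:ℝ)} ∪ {u | u ∈ Icc (0:ℝ) 1 ∧ R u = b}).Nonempty := ⟨1, Or.inl rfl⟩
  refine ⟨le_csInf hne ?_, csInf_le (firstBSet_bddBelow b R) (Or.inl rfl)⟩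
  rintro u (rfl | ⟨hu, -⟩)
  · exact zero_le_one
  · exact hu.1

/-- For continuous `R`, `lastA a R = 0` or `R (lastA a R) = a` (the supremum is attained). -/
theorem lastA_spec (hR : Continuous R) (a : ℂ) : lastA a R = 0 ∨ R (lastA a R) = a := by
  have hc : IsCompact ({(0:ℝ)} ∪ {u | u ∈ Icc (0:ℝ) 1 ∧ R u = a}) := by
    refine isCompact_singleton.union ?_
    have : {u | u ∈ Icc (0:ℝ) 1 ∧ R u = a} = Icc 0 1 ∩ R ⁻¹' {a} := by ext u; simp
    rw [this]
    exact isCompact_Icc.inter_right ((isClosed_singleton).preimage hR)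
  have hmem := hc.sSup_mem ⟨0, Or.inl rfl⟩
  rcases hmem with h0 | ⟨-, h1⟩
  · exact Or.inl h0
  · exact Or.inr h1

/-- For continuous `R`, `firstB b R = 1` or `R (firstB b R) = b`. -/
theorem firstB_spec (hR : Continuous R) (b : ℂ) : firstB b R = 1 ∨ R (firstB b R) = b := by
  have hc : IsCompact ({(1:ℝ)} ∪ {u | u ∈ Icc (0:ℝ) 1 ∧ R u = b}) := by
    refine isCompact_singleton.union ?_
    have : {u | u ∈ Icc (0:ℝ) 1 ∧ R u = b} = Icc 0 1 ∩ R ⁻¹' {b} := by ext u; simp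
    rw [this]
    exact isCompact_Icc.inter_right ((isClosed_singleton).preimage hR)
  have hmem := hc.sInf_mem ⟨1, Or.inl rfl⟩
  rcases hmem with h0 | ⟨-, h1⟩
  · exact Or.inl h0
  · exact Or.inr h1

/-- A visit of `a` happens no later than `lastA`. -/
theorem le_lastA_of_eq {u : ℝ} (hu : u ∈ Icc (0:ℝ) 1) (hRu : R u = a) : u ≤ lastA a R :=
  le_csSup (lastASet_bddAbove a R) (Or.inr ⟨hu, hRu⟩)

/-- A visit of `b` happens no earlier than `firstB`. -/
theorem firstB_le_of_eq {u : ℝ} (hu : u ∈ Icc (0:ℝ) 1) (hRu : R u = b) : firstB b R ≤ u :=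
  csInf_le (firstBSet_bddBelow b R) (Or.inr ⟨hu, hRu⟩)

/-- `h` maps `[0, 1]` into `[0, 1]`. -/
theorem repar_mem_Icc (hmono : Monotone h) (h0 : h 0 = 0) (h1 : h 1 = 1) {u : ℝ}
    (hu : u ∈ Icc (0:ℝ) 1) : h u ∈ Icc (0:ℝ) 1 :=
  ⟨h0 ▸ hmono hu.1, h1 ▸ hmono hu.2⟩

/-- **`h` carries the last visit of `a`.** -/
theorem repar_lastA (hh : Continuous h) (hmono : Monotone h) (h0 : h 0 = 0) (h1 : h 1 = 1) :
    h (lastA a (R ∘ h)) = lastA a R := by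
  unfold lastA
  rw [map_sSup hh hmono ⟨0, Or.inl rfl⟩ (lastASet_bddAbove a (R ∘ h)), image_union, image_singleton,
    h0]
  have := image_sep_Icc hh hmono zero_le_one (fun t => R t = a)
  rw [h0, h1] at this
  rw [← this]
  rfl

/-- **`h` carries the first visit of `b`.** -/
theorem repar_firstB (hh : Continuous h) (hmono : Monotone h) (h0 : h 0 = 0) (h1 : h 1 = 1) :
    h (firstB b (R ∘ h)) = firstB b R := by
  unfold firstB
  rw [map_sInf hh hmono ⟨1, Or.inl rfl⟩ (firstBSet_bddBelow b (R ∘ h)), image_union, image_singleton,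
    h1]
  have := image_sep_Icc hh hmono zero_le_one (fun t => R t = b)
  rw [h0, h1] at this
  rw [← this]
  rfl

/-- The trimmed time interval is empty on the reparametrised side iff it is empty on the other. -/
theorem repar_le_iff (hh : Continuous h) (hmono : Monotone h) (h0 : h 0 = 0) (h1 : h 1 = 1)
    (hab : a ≠ b) (hR : Continuous R) :
    lastA a (R ∘ h) ≤ firstB b (R ∘ h) ↔ lastA a R ≤ firstB b R := by
  constructor
  · intro hle
    rw [← repar_lastA hh hmono h0 h1 (a := a) (R := R), ← repar_firstB hh hmono h0 h1 (b := b) (R := R)]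
    exact hmono hle
  · intro hle
    by_contra hlt
    rw [not_le] at hlt
    -- then both visits happen: `R' i' = a`, `R' j' = b`, and `j = h j' ≤ h i' = i` forces `i = j`
    have hRh : Continuous (R ∘ h) := hR.comp hh
    have hi : (R ∘ h) (lastA a (R ∘ h)) = a := by
      rcases lastA_spec hRh a with h' | h'
      · exfalso; rw [h'] at hlt; exact (not_lt.2 (firstB_mem_Icc b (R ∘ h)).1) hlt
      · exact h'
    have hj : (R ∘ h) (firstB b (R ∘ h)) = b := by
      rcases firstB_spec hRh b with h' | h'
      · exfalso; rw [h'] at hlt; exact (not_lt.2 (lastA_mem_Icc a (R ∘ h)).2) hlt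
      · exact h'
    have hle' : h (firstB b (R ∘ h)) ≤ h (lastA a (R ∘ h)) := hmono hlt.le
    rw [repar_lastA hh hmono h0 h1, repar_firstB hh hmono h0 h1] at hle'
    have heq : lastA a R = firstB b R := le_antisymm hle hle'
    rw [comp_apply, repar_lastA hh hmono h0 h1, heq] at hi
    rw [comp_apply, repar_firstB hh hmono h0 h1] at hj
    exact hab (hi.symm.trans hj)

/-- **`h` carries the trimmed interval.** -/
theorem repar_image_Icc (hh : Continuous h) (hmono : Monotone h) (h0 : h 0 = 0) (h1 : h 1 = 1)
    (hab : a ≠ b) (hR : Continuous R) :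
    h '' Icc (lastA a (R ∘ h)) (firstB b (R ∘ h)) = Icc (lastA a R) (firstB b R) := by
  by_cases hle : lastA a (R ∘ h) ≤ firstB b (R ∘ h)
  · rw [image_Icc_of_monotone hh hmono hle, repar_lastA hh hmono h0 h1, repar_firstB hh hmono h0 h1]
  · have hle' : ¬ lastA a R ≤ firstB b R := by rwa [← repar_le_iff hh hmono h0 h1 hab hR]
    rw [Icc_eq_empty hle, Icc_eq_empty hle', image_empty]

/-- Transport of a constrained subset of the trimmed interval. -/
theorem repar_image_sep (hh : Continuous h) (hmono : Monotone h) (h0 : h 0 = 0) (h1 : h 1 = 1)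
    (hab : a ≠ b) (hR : Continuous R) (P : ℝ → Prop) :
    h '' {u | u ∈ Icc (lastA a (R ∘ h)) (firstB b (R ∘ h)) ∧ P (h u)} =
      {t | t ∈ Icc (lastA a R) (firstB b R) ∧ P t} := by
  by_cases hle : lastA a (R ∘ h) ≤ firstB b (R ∘ h)
  · rw [image_sep_Icc hh hmono hle, repar_lastA hh hmono h0 h1, repar_firstB hh hmono h0 h1]
  · have hle' : ¬ lastA a R ≤ firstB b R := by rwa [← repar_le_iff hh hmono h0 h1 hab hR]
    have h1' : {u | u ∈ Icc (lastA a (R ∘ h)) (firstB b (R ∘ h)) ∧ P (h u)} = ∅ := by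
      ext u; simp only [mem_setOf_eq, mem_empty_iff_false, iff_false, not_and]
      exact fun hu _ => hle (hu.1.trans hu.2)
    have h2' : {t | t ∈ Icc (lastA a R) (firstB b R) ∧ P t} = ∅ := by
      ext u; simp only [mem_setOf_eq, mem_empty_iff_false, iff_false, not_and]
      exact fun hu _ => hle' (hu.1.trans hu.2)
    rw [h1', h2', image_empty]

/-- The pushed polyline of `R ∘ h` is the pushed polyline of `R` composed with `h` (definitional). -/
theorem repar_attZ : attZ b Φ e (R ∘ h) = attZ b Φ e R ∘ h := rfl

/-- **The pushed middle arc is unchanged.** -/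
theorem repar_midSet (hh : Continuous h) (hmono : Monotone h) (h0 : h 0 = 0) (h1 : h 1 = 1)
    (hab : a ≠ b) (hR : Continuous R) : midSet a b Φ e (R ∘ h) = midSet a b Φ e R := by
  unfold midSet
  rw [repar_attZ, image_comp, repar_image_Icc hh hmono h0 h1 hab hR]

/-- **The access direction is unchanged.** -/
theorem repar_pAcc (hh : Continuous h) (hmono : Monotone h) (h0 : h 0 = 0) (h1 : h 1 = 1) :
    pAcc a Φ e (R ∘ h) = pAcc a Φ e R := by
  unfold pAcc
  rw [comp_apply, repar_lastA hh hmono h0 h1]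

/-- **The exit direction is unchanged.** -/
theorem repar_qEx (hh : Continuous h) (hmono : Monotone h) (h0 : h 0 = 0) (h1 : h 1 = 1) :
    qEx b Φ e (R ∘ h) = qEx b Φ e R := by
  unfold qEx
  rw [comp_apply, repar_firstB hh hmono h0 h1]

/-- The guard `R j ≠ b` is unchanged. -/
theorem repar_guard (hh : Continuous h) (hmono : Monotone h) (h0 : h 0 = 0) (h1 : h 1 = 1) :
    (R ∘ h) (firstB b (R ∘ h)) = R (firstB b R) := by
  rw [comp_apply, repar_firstB hh hmono h0 h1]

/-- **The access crossing parameter is unchanged.** -/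
theorem repar_sAcc (hh : Continuous h) (hmono : Monotone h) (h0 : h 0 = 0) (h1 : h 1 = 1)
    (hab : a ≠ b) (hR : Continuous R) : sAcc a b Φ e (R ∘ h) = sAcc a b Φ e R := by
  unfold sAcc
  rw [repar_pAcc hh hmono h0 h1, repar_midSet hh hmono h0 h1 hab hR]

/-- **The exit crossing parameter is unchanged.** -/
theorem repar_rEx (hh : Continuous h) (hmono : Monotone h) (h0 : h 0 = 0) (h1 : h 1 = 1)
    (hab : a ≠ b) (hR : Continuous R) : rEx a b Φ e (R ∘ h) = rEx a b Φ e R := by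
  unfold rEx
  rw [repar_qEx hh hmono h0 h1, repar_midSet hh hmono h0 h1 hab hR, repar_guard hh hmono h0 h1]

/-- **`h` carries the first cut time.** -/
theorem repar_uMid (hh : Continuous h) (hmono : Monotone h) (h0 : h 0 = 0) (h1 : h 1 = 1)
    (hab : a ≠ b) (hR : Continuous R) : h (uMid a b Φ e (R ∘ h)) = uMid a b Φ e R := by
  unfold uMid
  rw [repar_sAcc hh hmono h0 h1 hab hR, repar_pAcc hh hmono h0 h1, repar_attZ,
    map_sInf' hh hmono h0 ⟨lastA a (R ∘ h), fun u hu => hu.1.1⟩]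
  congr 1
  exact repar_image_sep hh hmono h0 h1 hab hR
    (fun t => attZ b Φ e R t = Φ ((sAcc a b Φ e R : ℂ) * pAcc a Φ e R))

/-- **`h` carries the second cut time.** -/
theorem repar_vMid (hh : Continuous h) (hmono : Monotone h) (h0 : h 0 = 0) (h1 : h 1 = 1)
    (hab : a ≠ b) (hR : Continuous R) : h (vMid a b Φ e (R ∘ h)) = vMid a b Φ e R := by
  unfold vMid
  rw [repar_rEx hh hmono h0 h1 hab hR, repar_qEx hh hmono h0 h1, repar_attZ, repar_guard hh hmono h0 h1,
    map_sSup' hh hmono h0]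
  · congr 1
    rw [image_union]
    congr 1
    · -- the singleton part `{u ∈ [i', j'] | R j = b ∧ u = j'}` is carried to `{t ∈ [i, j] | R j = b ∧ t = j}`
      ext t
      simp only [mem_image, mem_setOf_eq]
      constructor
      · rintro ⟨u, ⟨hu, hG, rfl⟩, rfl⟩
        refine ⟨?_, hG, repar_firstB hh hmono h0 h1⟩
        rw [repar_firstB hh hmono h0 h1]
        exact ⟨(repar_le_iff hh hmono h0 h1 hab hR).1 (hu.1.trans hu.2), le_rfl⟩
      · rintro ⟨ht, hG, rfl⟩
        refine ⟨firstB b (R ∘ h), ⟨⟨?_, le_rfl⟩, hG, rfl⟩, repar_firstB hh hmono h0 h1⟩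
        exact (repar_le_iff hh hmono h0 h1 hab hR).2 (ht.1.trans ht.2)
    · exact repar_image_sep hh hmono h0 h1 hab hR
        (fun t => R (firstB b R) ≠ b ∧ attZ b Φ e R t = Φ ((rEx a b Φ e R : ℂ) * qEx b Φ e R))
  · exact ⟨firstB b (R ∘ h), by rintro u (⟨hu, -⟩ | ⟨hu, -⟩) <;> exact hu.2⟩

/-- Strict order of the cut times passes FROM the original TO the reparametrised side. -/
theorem repar_lt_of_lt (hh : Continuous h) (hmono : Monotone h) (h0 : h 0 = 0) (h1 : h 1 = 1)
    (hab : a ≠ b) (hR : Continuous R) (hlt : uMid a b Φ e R < vMid a b Φ e R) :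
    uMid a b Φ e (R ∘ h) < vMid a b Φ e (R ∘ h) := by
  rw [← repar_uMid hh hmono h0 h1 hab hR (Φ := Φ) (e := e),
    ← repar_vMid hh hmono h0 h1 hab hR (Φ := Φ) (e := e)] at hlt
  exact hmono.reflect_lt hlt

/-- Weak order of the cut times passes from the reparametrised side to the original. -/
theorem repar_le_of_le (hh : Continuous h) (hmono : Monotone h) (h0 : h 0 = 0) (h1 : h 1 = 1)
    (hab : a ≠ b) (hR : Continuous R) (hle : uMid a b Φ e (R ∘ h) ≤ vMid a b Φ e (R ∘ h)) :
    uMid a b Φ e R ≤ vMid a b Φ e R := by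
  rw [← repar_uMid hh hmono h0 h1 hab hR (Φ := Φ) (e := e),
    ← repar_vMid hh hmono h0 h1 hab hR (Φ := Φ) (e := e)]
  exact hmono hle

/-- **The prescribed trace is unchanged** (when the reparametrised cut times are in order). -/
theorem repar_attSet (hh : Continuous h) (hmono : Monotone h) (h0 : h 0 = 0) (h1 : h 1 = 1)
    (hab : a ≠ b) (hR : Continuous R) (hle : uMid a b Φ e (R ∘ h) ≤ vMid a b Φ e (R ∘ h)) :
    attSet a b Φ e (R ∘ h) = attSet a b Φ e R := by
  unfold attSet
  rw [repar_pAcc hh hmono h0 h1, repar_qEx hh hmono h0 h1, repar_sAcc hh hmono h0 h1 hab hR,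
    repar_rEx hh hmono h0 h1 hab hR, repar_guard hh hmono h0 h1, repar_attZ, image_comp,
    image_Icc_of_monotone hh hmono hle, repar_uMid hh hmono h0 h1 hab hR, repar_vMid hh hmono h0 h1 hab hR]

end Data

end Summit.CriticalPhenomena.SAWScalingLimit.Theorems.AttachReversal

end
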